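import Literature.Geometry.Lorentzian.InteriorKerrGluing
import Literature.Geometry.Lorentzian.ShortPulseCylinderData
import HarnessLib

/-!
# The near-Schwarzschild vacuum pocket of a collapsing spacetime (Li–Mei 2020, Thm 2.1 + §2.2)

J. Li, H. Mei, *A construction of collapsing spacetimes in vacuum*, Comm. Math. Phys. 378 (2020)
1343–1389 = arXiv:2005.01249 [LiMei2020]: the INPUT of their interior gluing theorem (Thm 2.2 =
Prop. 4.1, vendored as `LiMei.interiorKerrGluing`, `InteriorKerrGluing.lean`) is produced by their
**Theorem 2.1** (§2.1, arXiv p. 7; proved in §3 from Christodoulou's short-pulse method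
[Christodoulou2008]) together with the choice of hypersurfaces of **§2.2** (arXiv p. 8). This file
vendors that input as the named fact `LiMei.nearSchwarzschildPocket` (D-0014), in the transported
vocabulary of `InteriorKerrGluing.lean` (same annulus, same model cylinder map, same closeness
predicate), so that the two facts compose literally.

## The printed statements

* Thm 2.1 (p. 7): "Let `δ > 0` be a small number, `m₀ > 0`, `u₀ < u₁ < 0` and `k` be a large integer.
  Then there exists an `ε₀ > 0` (only depending on `m₀`), such that if `δ` is sufficiently small,
  the solution `g` of the vacuum Einstein equations exists for `0 ≤ u̲ ≤ δ + ε₀`, `u₀ ≤ u ≤ u₁`"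
  (characteristic data on `C_{u₀}`: Minkowskian before `u̲ = 0`, a short pulse of width `δ`, p. 7)
  "In addition, the solution `g` in `δ ≤ u̲ ≤ δ + ε₀`, `u₀ ≤ u ≤ u₁` is `δ^{1/2}`-close to the
  Schwarzschild metric `g_{m₀}` with mass `m₀` also defined in the same region in the `C^k`
  topology." With `|u₀| < 2m₀` (p. 7, "we may set in particular `|u₀| < 2m₀`") this region lies
  inside the Schwarzschild black hole.
* §2.2 (p. 8): "We first choose a function `Σ⁺_II(u̲)` such that the hypersurface `u = Σ⁺_II(u̲)`,
  `δ ≤ u̲ ≤ δ + ε₀`, is exactly the hypersurface `r_{g_{m₀}} = r₀ < 2m₀` relative to the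
  Schwarzschild metric `g_{m₀}`. We denote this hypersurface … by `H` and the initial data induced
  on it by `g` by `(ḡ, k̄)`. A key property of `H` is that `H` will not shrink as `δ → 0` because `ε₀`
  does not depend on `δ`. The closeness to Schwarzschild metric implies that, given large integer
  `k` …, `‖ḡ − ḡ_{m₀}‖_{C^k(ḡ_{m₀})} + ‖k̄ − k̄_{m₀}‖_{C^k(ḡ_{m₀})} ≤ C δ^{1/2}` if `δ` is sufficiently
  small, where `(ḡ_{m₀}, k̄_{m₀})` is the initial data of the Schwarzschild metric `g_{m₀}` induced on
  `Σ⁺_II`" (= the cylinder data of `InteriorKerrGluing.lean`, their (4.1)); and "It is then easy to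
  extend `Σ⁺_II` inside to obtain `Σ⁺_III` and `Σ⁺_IV`, which are chosen to be in the form `u = f(u̲)`
  for some decreasing function `f`" — `Σ⁺_IV` lies in the Minkowskian region and closes up regularly
  at the centre, `Σ⁺_III` in the pulse region; the data induced on `Σ⁺_II ∪ Σ⁺_III ∪ Σ⁺_IV` by the
  vacuum solution `g` solve the vacuum constraints (data induced on a spacelike hypersurface of a
  vacuum spacetime, Choquet-Bruhat 2009, Ch. VI, Thm. 3.3) and form a smooth datum on a 3-ball whose
  outer collar is `H`.

So: for a fixed geometry (`m₀`, `r₀ < 2m₀`, the `t`-length of `H`, none depending on `δ`) and every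
`k` and `ε > 0` there is a smooth VACUUM datum on a 3-ball whose collar is `ε`-close in `C^k` to the
Schwarzschild(`m₀`)-cylinder data `{r = r₀}` — the near-Schwarzschild POCKET.

## Transport to the tree (identical to `InteriorKerrGluing.lean`)

The pocket is placed on `E3 ⊇ {‖y‖ < ρ₂}` with the collar `H ≅ (t₁, t₂) × S²` realised as the annulus
`{ρ₁ < ‖y‖ < ρ₂}` through the model cylinder map `LiMei.schwCylMap r₀ 0` (`t* = ‖y‖`; `t* = t + const`
on `{r = r₀}`, and `∂_{t*}` is tangent and Killing, so the placement of the `t`-interval is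
immaterial), the inner ball `{‖y‖ ≤ ρ₁}` carrying `Σ⁺_III ∪ Σ⁺_IV ∪` the inner part of `H` (a smooth
3-ball bounded by a collar sphere; its polar identification with a round ball extends the collar's),
and the datum extended smoothly but arbitrarily beyond `ρ₂` (only `{‖y‖ < ρ₂}` is asserted vacuum).
Closeness is `LiMei.NearSchwarzschildCylinder M r₁ r₀ ρ₁ ρ₂ k ε` (sup-`C^k` of Cartesian derivatives
on the annulus, which on the relatively compact annulus is dominated by / dominates the printed
`C^k(ḡ_{m₀})` norms up to constants depending only on the geometry, so `∀ k ∀ ε` transports; the chart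
inner radius `r₁ < r₀` of the Kerr–Schild chart is immaterial, `LiMei.nearSchwarzschildCylinder_iff`).

## Specialisation / what is NOT stated

* Only the EXISTENCE of one geometry is recorded (`∃ M r₀ ρ₁ ρ₂`), although the source allows every
  `m₀ > 0` and, by the freedom in `u₀, u₁`, cylinder radii `r₀` filling `(0, 2m₀)`.
* Regularity: Thm 2.1 is stated in `C^k` for every `k`; the tree's `InitialDataSet` is `C^∞` and the
  short-pulse solution is smooth for smooth seed data (Christodoulou 2008, Thm. 16.1/17.1), which is
  how §2.2 uses it ("a smooth, complete asymptotically flat Cauchy data"). Nothing about developments,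
  trapped surfaces or the regions `I–IV` of their Step 3 is stated here.
* This is NOT the interior gluing (Prop. 4.1 = `LiMei.interiorKerrGluing`) and asserts nothing exact.
-/

noncomputable section

open Bundle Set TopologicalSpace
open scoped Manifold ContDiff Topology

namespace Literature.Geometry.Lorentzian

namespace LiMei

/-- **The near-Schwarzschild vacuum pocket** (J. Li, H. Mei, Comm. Math. Phys. 378 (2020) =
arXiv:2005.01249, **Thm. 2.1** (§2.1, p. 7) with the hypersurface `Σ⁺_II ∪ Σ⁺_III ∪ Σ⁺_IV` of
**§2.2** (p. 8); short-pulse interior after Christodoulou 2008), transported to `E3` exactly as the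
companion fact `LiMei.interiorKerrGluing`: there is a geometry — a background mass `M` with cylinder
radius `0 < r₀ < 2M` (the spacelike cylinder `{r = r₀}` inside the Schwarzschild black hole) and an
annulus `{ρ₁ < ‖y‖ < ρ₂}`, `1 ≤ ρ₁ < ρ₂` (the cylinder piece `H`, which "will not shrink as `δ → 0`")
— such that for every chart inner radius `0 < r₁ < r₀`, every order `k` and every `ε > 0` (their
`C δ^{1/2} < ε` for `δ` small) there is a smooth datum `D` on `E3` which solves the VACUUM constraint
equations on the ball `{‖y‖ < ρ₂}` (data induced by the vacuum solution on the spacelike 3-ball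
`Σ⁺_IV ∪ Σ⁺_III ∪ H`, Minkowskian near the centre) and whose data on the annulus are `ε`-close in
sup-`C^k` to the Schwarzschild(`M`) cylinder data `(ḡ_{m₀}, k̄_{m₀})` of `{r = r₀}` along
`schwCylMap r₀ 0` (`LiMei.NearSchwarzschildCylinder`) — precisely the input of Prop. 4.1. Named fact
(D-0014); theorem in print (Thm. 2.1 proved in §3). [cite: LiMei2020, Thm. 2.1 and §2.2] -/
def nearSchwarzschildPocket : Prop :=
  ∀ [Kerr.Facts], ∃ (M r₀ ρ₁ ρ₂ : ℝ), 0 < r₀ ∧ r₀ < 2 * M ∧ 1 ≤ ρ₁ ∧ ρ₁ < ρ₂ ∧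
    ∀ (r₁ : ℝ), 0 < r₁ → r₁ < r₀ → ∀ (k : ℕ) (ε : ℝ), 0 < ε →
      ∃ D : InitialDataSet (𝓡 3) E3,
        IsVacuumOn {y : E3 | ‖y‖ < ρ₂} D ∧ NearSchwarzschildCylinder M r₁ r₀ ρ₁ ρ₂ k ε D
  -- TODO(general form): every `m₀ > 0` and every `r₀ ∈ (0, 2m₀)` (freedom in `u₀ < u₁ < 0`,
  -- `|u₀| < 2m₀`); data on the abstract 3-ball `Σ⁺_II ∪ Σ⁺_III ∪ Σ⁺_IV` with closeness in
  -- `C^k(ḡ_{m₀})` on `H ≅ (t₁, t₂) × S²` (Li–Mei Thm 2.1 + §2.2 verbatim).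

/-! ### Reduction to the short-pulse cylinder data -/

/-- **The pocket is a specialisation of the short-pulse cylinder data.** The named fact
`LiMei.shortPulseCylinderData` (`ShortPulseCylinderData.lean`: Li–Mei arXiv:2005.01249, Thm. 2.1
with the estimate of §2.2, transported — for EVERY mass `M > 0` a cylinder radius `0 < r₀ < 2M` and a
collar length `ℓ > 0` serving every placement `1 ≤ ρ₁` of the collar) yields
`nearSchwarzschildPocket` at the geometry `M = 1`, `ρ₁ = 1`, `ρ₂ = 1 + ℓ`: both facts vendor the same
printed statements in the same vocabulary (`IsVacuumOn`, `NearSchwarzschildCylinder`), the pocket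
recording only the existence of one geometry. So the discharge `nearSchwarzschildPocket_holds` is
this theorem applied to `shortPulseCylinderData_holds` once the latter (Christodoulou's short-pulse
formation of black holes, Li–Mei §6) is in the tree. [cite: LiMei2020, Thm. 2.1 and §2.2] -/
theorem nearSchwarzschildPocket_of_shortPulseCylinderData (h : shortPulseCylinderData) :
    nearSchwarzschildPocket := by
  intro _
  obtain ⟨r₀, ℓ, hr₀, hr₀M, hℓ, hD⟩ := h 1 one_pos
  refine ⟨1, r₀, 1, 1 + ℓ, hr₀, hr₀M, le_rfl, lt_add_of_pos_right 1 hℓ, ?_⟩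
  intro r₁ hr₁ hr₁r₀ k ε hε
  exact hD r₁ 1 hr₁ hr₁r₀ le_rfl k ε hε

end LiMei

end Literature.Geometry.Lorentzian

end
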